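import Mathlib
import HarnessLib
import Summits.HubbardSuperconductivity.HubbardSuperconductivity.Theorems.KLProgrammeLatticePeriodicExtension

/-!
# Route `KLProgramme` — ENGINE stmt-HubbardSuperconductivity-20437 `KLRegimeEngineV17F2`, row (c) value lane: QUASI-LIPSCHITZ data of the global McShane extension from CELL
# lattice data (brick L1-core of cure (A″) route 3′ of located «(c)-OUT-COOPER-ANTIPODE»; cell gate-hubbard-kl, seat hubbard-kl-k3c2-p2 g25)

WHY.  Route 3′ (CELL-SIGNATURES.md §G): the planar vertex weight is `E = klpeExt g B K` (…LatticePeriodicExtension: agrees with `g` on the lattice, `2K`-Lipschitz, periodic),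
`K` the GLOBAL torus-Lipschitz constant of `g` (any size).  If `g` is `L_c`-Lipschitz on a CELL `S` of lattice momenta, then for planar points `p, q` all of whose torus-nearest
lattice points lie in `S` the extension is QUASI-Lipschitz with the cell constant: `‖E p − E q‖ ≤ L_c·|p − q|_𝕋 + (2L_c + 4K)·π/L` (nearest lattice point at torus distance
`≤ π/L`, periodicity, `E = g` on the lattice).  This is the datum `A₁(θ)|t − t'| + δ_A(θ)` of `klfb_ray_bubble_norm_le_tube_quasi` (…ForwardBubbleRayTubeQuasi) on rays whose tube
segment stays in the cell; `δ_A ∝ (K + L_c)/L` books in the lattice slot.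
* `klpe_exists_int_torusAbs_eq` (`|x|_𝕋 = |x − 2πm|` for some `m : ℤ`), `klpe_exists_near_lattice` (every planar point is, up to a `2πℤ²` shift, within sup-distance `π/L` of a
  lattice momentum, at torus distance `≤ π/L`), `klpe_ext_add_int_vec` (invariance of `klpeExt` under `2πℤ²` shifts);
* **`klpe_ext_quasi_lipschitz_of_cell`**.
Pure analysis; nothing about the model is asserted.  0 kit · 0 lit.
-/

noncomputable section

namespace Summit.HubbardSuperconductivity.HubbardSuperconductivity.Theorems.KLRegimeSplit

set_option linter.dupNamespace false -- summit = problem name (single-conjunct summit), D-0017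

open Real Set Finset Literature.MathematicalPhysics.QuantumLattice
open Literature.Probability.LatticeModels hiding torusSupNorm
open Summit.HubbardSuperconductivity.HubbardSuperconductivity.Theorems.KLProgrammeLegKernels
open Summit.HubbardSuperconductivity.HubbardSuperconductivity.Theorems.EngineV8

/-! ## §1 Nearest lattice momentum -/

/-- `|x|_𝕋 = |x − m·2π|` for the integer `m = toIocDiv`. -/
theorem klpe_exists_int_torusAbs_eq (x : ℝ) : ∃ m : ℤ, torusAbs x = |x - m * (2 * Real.pi)| := by
  refine ⟨toIocDiv Real.two_pi_pos (-Real.pi) x, ?_⟩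
  unfold torusAbs
  rw [← self_sub_toIocDiv_zsmul Real.two_pi_pos (-Real.pi) x, zsmul_eq_mul]

/-- One coordinate: every real `x` is within `π/L` of a grid value `2π·(k.val)/L` UP TO a shift by `2πℤ` — explicitly, with `m = round (xL/2π)`, `k = (m : ZMod L)` and the shift
`z = −⌊m/L⌋`: `|x + 2πz − 2π·k.val/L| ≤ π/L`. -/
theorem klpe_exists_near_grid (L : ℕ) [NeZero L] (x : ℝ) :
    ∃ (k : ZMod L) (z : ℤ), |x + 2 * Real.pi * (z : ℝ) - 2 * Real.pi * ((k.val : ℕ) : ℝ) / L| ≤ Real.pi / L := by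
  have hL : (0 : ℝ) < L := by exact_mod_cast Nat.pos_of_ne_zero (NeZero.ne L)
  have hπ := Real.pi_pos
  set u : ℝ := x * L / (2 * Real.pi) with hu
  set m : ℤ := round u with hm
  refine ⟨(m : ZMod L), -(m / (L : ℤ)), ?_⟩
  have hval : (((m : ZMod L).val : ℕ) : ℤ) = m % (L : ℤ) := ZMod.val_intCast m
  have hval' : (((m : ZMod L).val : ℕ) : ℝ) = ((m % (L : ℤ) : ℤ) : ℝ) := by exact_mod_cast hval
  rw [hval']
  have hmod : ((m % (L : ℤ) : ℤ) : ℝ) = (m : ℝ) - (L : ℝ) * ((m / (L : ℤ) : ℤ) : ℝ) := by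
    have h := Int.emod_def m (L : ℤ)
    rw [h]; push_cast; ring
  rw [hmod]
  have hround : |u - m| ≤ 1 / 2 := by rw [hm]; exact abs_sub_round u
  have hx : x = 2 * Real.pi * u / L := by rw [hu]; field_simp
  rw [hx]
  have e : 2 * Real.pi * u / L + 2 * Real.pi * ((-(m / (L : ℤ)) : ℤ) : ℝ) - 2 * Real.pi * ((m : ℝ) - (L : ℝ) * ((m / (L : ℤ) : ℤ) : ℝ)) / L =
      2 * Real.pi / L * (u - m) := by
    push_cast; field_simp; ring
  rw [e, abs_mul, abs_of_pos (by positivity)]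
  calc 2 * Real.pi / L * |u - m| ≤ 2 * Real.pi / L * (1 / 2) := mul_le_mul_of_nonneg_left hround (by positivity)
    _ = Real.pi / L := by ring

/-- **Nearest lattice momentum**: for every `p : ℝ × ℝ` there are a lattice momentum `k̃` and a `2πℤ²`-shift `p'` of `p` with `dist p' (P k̃) ≤ π/L` (sup metric) and
`|p − P k̃|_𝕋 ≤ π/L`. -/
theorem klpe_exists_near_lattice (L : ℕ) [NeZero L] (p : ℝ × ℝ) :
    ∃ (k : TorusSite 2 L) (z : Fin 2 → ℤ), dist (p.1 + 2 * Real.pi * (z 0 : ℝ), p.2 + 2 * Real.pi * (z 1 : ℝ)) (klpeP L k) ≤ Real.pi / L ∧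
      torusSupNorm (p - klpeP L k) ≤ Real.pi / L := by
  obtain ⟨k₁, z₁, h₁⟩ := klpe_exists_near_grid L p.1
  obtain ⟨k₂, z₂, h₂⟩ := klpe_exists_near_grid L p.2
  refine ⟨![k₁, k₂], ![z₁, z₂], ?_, ?_⟩
  · rw [Prod.dist_eq, Real.dist_eq, Real.dist_eq]
    unfold klpeP latticeMomentum
    simp only [Matrix.cons_val_zero, Matrix.cons_val_one]
    exact max_le h₁ h₂
  · have hP : torusSupNorm (p - klpeP L ![k₁, k₂]) =
        torusSupNorm ((p.1 + 2 * Real.pi * (z₁ : ℝ), p.2 + 2 * Real.pi * (z₂ : ℝ)) - klpeP L ![k₁, k₂]) := by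
      have h := klpe_tau_add_int_vec (p - klpeP L ![k₁, k₂]) ![z₁, z₂]
      rw [← h]
      congr 1
      ext <;> simp [klpeP, sub_add_eq_add_sub]
    rw [hP]
    refine (klpe_tau_sub_le_dist _ _).trans ?_
    rw [Prod.dist_eq, Real.dist_eq, Real.dist_eq]
    unfold klpeP latticeMomentum
    simp only [Matrix.cons_val_zero, Matrix.cons_val_one]
    exact max_le h₁ h₂

/-! ## §2 Shift invariance and the quasi-Lipschitz datum from cell data -/

section Ext

variable {L : ℕ} [NeZero L]

/-- `klpeExt` is invariant under `2πℤ²` shifts. -/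
theorem klpe_ext_add_int_vec (g : TorusSite 2 L → ℂ) (B K : ℝ) (p : ℝ × ℝ) (z : Fin 2 → ℤ) :
    klpeExt g B K (p.1 + 2 * Real.pi * (z 0 : ℝ), p.2 + 2 * Real.pi * (z 1 : ℝ)) = klpeExt g B K p := by
  have h1 : Function.Periodic (fun x => klpeExt g B K (x, p.2 + 2 * Real.pi * (z 1 : ℝ))) (2 * Real.pi) := fun x =>
    klpe_ext_periodic₁ g B K x _
  have h2 : Function.Periodic (fun y => klpeExt g B K (p.1, y)) (2 * Real.pi) := fun y => klpe_ext_periodic₂ g B K _ y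
  have e1 := (h1.int_mul (z 0)) p.1
  have e2 := (h2.int_mul (z 1)) p.2
  rw [show p.1 + 2 * Real.pi * (z 0 : ℝ) = p.1 + (z 0 : ℝ) * (2 * Real.pi) by ring, e1,
    show p.2 + 2 * Real.pi * (z 1 : ℝ) = p.2 + (z 1 : ℝ) * (2 * Real.pi) by ring, e2]

/-- **QUASI-LIPSCHITZ DATA OF THE GLOBAL EXTENSION FROM CELL DATA.**  `g` with global data (`‖g‖ ≤ B`, torus-Lipschitz `K`) and `L_c`-Lipschitz on a cell
`S` (`0 ≤ K`, `0 ≤ L_c`); if every lattice momentum at torus distance `≤ π/L` from `p` (resp. `q`) lies in `S`, then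
`‖klpeExt g B K p − klpeExt g B K q‖ ≤ L_c·|p − q|_𝕋 + (2L_c + 4K)·(π/L)`. -/
theorem klpe_ext_quasi_lipschitz_of_cell {g : TorusSite 2 L → ℂ} {B K Lc : ℝ} (hK : 0 ≤ K) (hLc : 0 ≤ Lc)
    (hgB : ∀ k, ‖g k‖ ≤ B) (hg : ∀ k k', ‖g k - g k'‖ ≤ K * klTorusNorm L (k - k'))
    {S : Finset (TorusSite 2 L)} (hS : ∀ k ∈ S, ∀ k' ∈ S, ‖g k - g k'‖ ≤ Lc * klTorusNorm L (k - k')) {p q : ℝ × ℝ}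
    (hp : ∀ k : TorusSite 2 L, torusSupNorm (p - klpeP L k) ≤ Real.pi / L → k ∈ S)
    (hq : ∀ k : TorusSite 2 L, torusSupNorm (q - klpeP L k) ≤ Real.pi / L → k ∈ S) :
    ‖klpeExt g B K p - klpeExt g B K q‖ ≤ Lc * torusSupNorm (p - q) + (2 * Lc + 4 * K) * (Real.pi / L) := by
  obtain ⟨kp, zp, hdp, htp⟩ := klpe_exists_near_lattice L p
  obtain ⟨kq, zq, hdq, htq⟩ := klpe_exists_near_lattice L q
  have hkp : kp ∈ S := hp kp htp
  have hkq : kq ∈ S := hq kq htq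
  set p' : ℝ × ℝ := (p.1 + 2 * Real.pi * (zp 0 : ℝ), p.2 + 2 * Real.pi * (zp 1 : ℝ)) with hp'
  set q' : ℝ × ℝ := (q.1 + 2 * Real.pi * (zq 0 : ℝ), q.2 + 2 * Real.pi * (zq 1 : ℝ)) with hq'
  have hEp : klpeExt g B K p = klpeExt g B K p' := (klpe_ext_add_int_vec g B K p zp).symm
  have hEq : klpeExt g B K q = klpeExt g B K q' := (klpe_ext_add_int_vec g B K q zq).symm
  have hgp : klpeExt g B K (klpeP L kp) = g kp := klpe_ext_apply_lattice hgB hg kp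
  have hgq : klpeExt g B K (klpeP L kq) = g kq := klpe_ext_apply_lattice hgB hg kq
  -- the three pieces
  have h1 : ‖klpeExt g B K p' - klpeExt g B K (klpeP L kp)‖ ≤ 2 * K * (Real.pi / L) :=
    (klpe_ext_lipschitz g B hK p' (klpeP L kp)).trans (mul_le_mul_of_nonneg_left hdp (by positivity))
  have h3 : ‖klpeExt g B K (klpeP L kq) - klpeExt g B K q'‖ ≤ 2 * K * (Real.pi / L) := by
    rw [norm_sub_rev]
    exact (klpe_ext_lipschitz g B hK q' (klpeP L kq)).trans (mul_le_mul_of_nonneg_left hdq (by positivity))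
  have h2 : ‖g kp - g kq‖ ≤ Lc * (torusSupNorm (p - q) + 2 * (Real.pi / L)) := by
    refine (hS kp hkp kq hkq).trans (mul_le_mul_of_nonneg_left ?_ hLc)
    rw [← klpe_tau_P_sub_P]
    -- `|P kp − P kq|_𝕋 ≤ |P kp − p|_𝕋 + |p − q|_𝕋 + |q − P kq|_𝕋`
    have t1 := klpe_tau_add_le (klpeP L kp - p) (p - klpeP L kq)
    have t2 := klpe_tau_add_le (p - q) (q - klpeP L kq)
    rw [sub_add_sub_cancel] at t1 t2
    have e1 : torusSupNorm (klpeP L kp - p) = torusSupNorm (p - klpeP L kp) := by rw [← neg_sub, klpe_tau_neg]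
    linarith [e1.le, e1.ge]
  calc ‖klpeExt g B K p - klpeExt g B K q‖
      = ‖(klpeExt g B K p' - klpeExt g B K (klpeP L kp)) + (g kp - g kq) + (klpeExt g B K (klpeP L kq) - klpeExt g B K q')‖ := by
        rw [hEp, hEq, ← hgp, ← hgq]; congr 1; abel
    _ ≤ ‖klpeExt g B K p' - klpeExt g B K (klpeP L kp)‖ + ‖g kp - g kq‖ + ‖klpeExt g B K (klpeP L kq) - klpeExt g B K q'‖ :=
        norm_add₃_le
    _ ≤ 2 * K * (Real.pi / L) + Lc * (torusSupNorm (p - q) + 2 * (Real.pi / L)) + 2 * K * (Real.pi / L) := by linarith [h1, h2, h3]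
    _ = Lc * torusSupNorm (p - q) + (2 * Lc + 4 * K) * (Real.pi / L) := by ring

end Ext

end Summit.HubbardSuperconductivity.HubbardSuperconductivity.Theorems.KLRegimeSplit

end
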